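import Literature.MathematicalPhysics.QuantumLattice.HubbardTorus2DTiling
import Literature.MathematicalPhysics.QuantumLattice.HubbardModelParticleHoleProofs
import Literature.MathematicalPhysics.QuantumLattice.InfVolFermionState
import HarnessLib

/-!
# The open box versus the torus: sector ground-state energies of the 2D Hubbard model

Topic `Literature/MathematicalPhysics/QuantumLattice`; namespace
`Literature.MathematicalPhysics.QuantumLattice.ThermodynamicLimit`. Companion of
`HubbardTorus2DTiling.lean` / `HubbardTorus2DEnergyDensity.lean` (the thermodynamic limit of the
ground-state energy density along tori) and of `HubbardFermionInteractionLocalHamiltonian.lean`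
(the free-boundary box Hamiltonians of the infinite-volume formalism are
`hamiltonian (polyGraph Λ) t U`). Everything is PROVED; no definition, no named fact.

## Results

* `groundEnergyAt_le_of_adj_discrepancy`: two graphs on the same ordered vertex set whose
  adjacencies differ on at most `k` ordered pairs have sector ground-state energies within
  `2|t| k` of each other (variational principle + `|⟨c_{xσ}ψ, c_{yσ}ψ⟩| ≤ 1`).
* `exists_equiv_polySite_halfOpenBox_two`: a site bijection between the sites of the box
  `[0,ℓ)² ⊆ ℤ²` (`PolySite (halfOpenBox 2 ℓ)`) and the rectangular torus `Fin ℓ ×ₗ Fin ℓ`, reading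
  off the two coordinates.
* `card_discrepancy_box_torus_le`: under such a bijection, box adjacency (`polyGraph`) and torus
  adjacency (`fermionRectTorusGraph ℓ ℓ`) differ on at most `16 ℓ` ordered pairs (every
  discrepancy is a torus bond issuing from one of the `≤ 4ℓ` boundary sites of the box).
* `groundEnergyAt_rect_le_polyGraph_halfOpenBox`: **`E_{ℓ×ℓ torus}(N) ≤ E_{[0,ℓ)² box}(N) + 32|t| ℓ`**
  for every sector `N ≤ 2ℓ²` — with `energyDensity2D_le` this bounds the free-boundary box energies
  from below by the thermodynamic energy density.

Ruelle, *Statistical Mechanics* (1969) §2.2 / §3.3 (boundary conditions do not affect the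
thermodynamic limit of the energy density).
-/

noncomputable section

open Matrix Finset
open scoped ComplexOrder BigOperators

namespace Literature.MathematicalPhysics.QuantumLattice

open Literature.Probability.LatticeModels HubbardWave0

namespace ThermodynamicLimit

/-! ### Graphs differing on few bonds -/

section Discrepancy

variable {Λ : Type*} [LinearOrder Λ] [Fintype Λ]

/-- **Few differing bonds, close sector energies.** If the adjacencies of `G'` and `G` on the same
ordered vertex set differ on at most `k` ordered pairs, then `E_{G'}(N) ≤ E_G(N) + 2|t| k` for every
sector `N ≤ 2|Λ|` (for every unit trial vector the two energies differ by the hopping over the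
discrepant bonds, each `≤ 2|t|` in modulus; then take the infimum). [folklore] -/
theorem groundEnergyAt_le_of_adj_discrepancy (G G' : SimpleGraph Λ) [DecidableRel G.Adj]
    [DecidableRel G'.Adj] (t U : ℝ) {k : ℕ}
    (hk : #{p : Λ × Λ | ¬ (G'.Adj p.1 p.2 ↔ G.Adj p.1 p.2)} ≤ k) {N : ℕ} (hN : N ≤ 2 * Fintype.card Λ) :
    groundEnergyAt G' t U N ≤ groundEnergyAt G t U N + 2 * |t| * k := by
  -- for every unit vector the energies differ by at most `2|t| k`
  have key : ∀ ψ : Fock (Orb Λ), star ψ ⬝ᵥ ψ = 1 →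
      (expect (hamiltonian G' t U) ψ).re ≤ (expect (hamiltonian G t U) ψ).re + 2 * |t| * k := by
    intro ψ hψ1
    set b : Λ → Λ → ℂ := fun x y =>
      ∑ σ : Fin 2, star (annihilation (orb x σ) *ᵥ ψ) ⬝ᵥ (annihilation (orb y σ) *ᵥ ψ) with hb
    have hb2 : ∀ x y, ‖b x y‖ ≤ 2 := by
      intro x y
      calc ‖b x y‖ ≤ ∑ σ : Fin 2, ‖star (annihilation (orb x σ) *ᵥ ψ) ⬝ᵥ (annihilation (orb y σ) *ᵥ ψ)‖ :=
            norm_sum_le _ _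
        _ ≤ ∑ _σ : Fin 2, (1 : ℝ) := Finset.sum_le_sum fun σ _ => norm_dotProduct_annihilation_le_one hψ1 _ _
        _ = 2 := by simp
    have hG' : expect (hamiltonian G' t U) ψ =
        -(t : ℂ) * (∑ x, ∑ y, if G'.Adj x y then b x y else 0) +
          (U : ℂ) * ∑ x : Λ, star ψ ⬝ᵥ (numberOp x 0 *ᵥ (numberOp x 1 *ᵥ ψ)) := by
      rw [expect, dotProduct_hamiltonian_mulVec]
      simp_rw [sum_ite_const_cond]
      rfl
    have hG : expect (hamiltonian G t U) ψ =
        -(t : ℂ) * (∑ x, ∑ y, if G.Adj x y then b x y else 0) +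
          (U : ℂ) * ∑ x : Λ, star ψ ⬝ᵥ (numberOp x 0 *ᵥ (numberOp x 1 *ᵥ ψ)) := by
      rw [expect, dotProduct_hamiltonian_mulVec]
      simp_rw [sum_ite_const_cond]
      rfl
    have hdiff : expect (hamiltonian G' t U) ψ = expect (hamiltonian G t U) ψ +
        -(t : ℂ) * ((∑ x, ∑ y, if G'.Adj x y then b x y else 0) - ∑ x, ∑ y, if G.Adj x y then b x y else 0) := by
      rw [hG', hG]; ring
    have hnorm := norm_sum_ite_sub_sum_ite_le G'.Adj G.Adj b zero_le_two hb2 hk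
    rw [hdiff, Complex.add_re]
    have h1 : (-(t : ℂ) * ((∑ x, ∑ y, if G'.Adj x y then b x y else 0) -
        ∑ x, ∑ y, if G.Adj x y then b x y else 0)).re ≤ 2 * |t| * k := by
      refine (Complex.re_le_norm _).trans ?_
      rw [norm_mul, norm_neg, Complex.norm_real, Real.norm_eq_abs]
      calc |t| * ‖(∑ x, ∑ y, if G'.Adj x y then b x y else 0) - ∑ x, ∑ y, if G.Adj x y then b x y else 0‖
          ≤ |t| * (k * 2) := mul_le_mul_of_nonneg_left hnorm (abs_nonneg t)
        _ = 2 * |t| * k := by ring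
    linarith
  -- pass to the infima
  have hcard : N ≤ Fintype.card (Orb Λ) := by rwa [card_orb]
  unfold groundEnergyAt
  refine le_of_forall_pos_lt_add fun ε hε => ?_
  obtain ⟨ψ, hψN, hψ1, hψlt⟩ := exists_re_expect_lt (hamiltonian G t U) hcard
    (b := groundEnergy (hamiltonian G t U) N + ε) (by linarith)
  have h1 := groundEnergy_le_re_expect (hamiltonian G' t U) hψN hψ1
  have h2 := key ψ hψ1
  linarith

end Discrepancy

/-! ### The box `[0,ℓ)²` and the torus `ℤ/ℓℤ × ℤ/ℓℤ` -/

section Box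

variable {ℓ : ℕ}

/-- Every element of `Fin 2` is `0` or `1`. [folklore] -/
theorem fin_two_eq_zero_or_one : ∀ i : Fin 2, i = 0 ∨ i = 1 := by decide

/-- Coordinates of the sites of `[0,ℓ)²` are in `[0, ℓ)`. [folklore] -/
theorem coord_mem_of_polySite_halfOpenBox (a : PolySite (halfOpenBox 2 ℓ)) (i : Fin 2) :
    0 ≤ ofLex a.1 i ∧ ofLex a.1 i < ℓ :=
  (mem_halfOpenBox.1 (PolySite.ofLex_mem a)) i

/-- **The sites of the box `[0,ℓ)² ⊆ ℤ²` are those of the rectangular torus `Fin ℓ ×ₗ Fin ℓ`**: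
there is a site bijection reading off the two coordinates. [folklore] -/
theorem exists_equiv_polySite_halfOpenBox_two (ℓ : ℕ) :
    ∃ f : PolySite (halfOpenBox 2 ℓ) ≃ Fin ℓ ×ₗ Fin ℓ,
      (∀ a, (((ofLex (f a)).1 : ℕ) : ℤ) = ofLex a.1 0) ∧ (∀ a, (((ofLex (f a)).2 : ℕ) : ℤ) = ofLex a.1 1) := by
  have hlt : ∀ (a : PolySite (halfOpenBox 2 ℓ)) (i : Fin 2), (ofLex a.1 i).toNat < ℓ := fun a i => by
    have h := coord_mem_of_polySite_halfOpenBox a i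
    omega
  set g : PolySite (halfOpenBox 2 ℓ) → Fin ℓ ×ₗ Fin ℓ := fun a =>
    toLex (⟨(ofLex a.1 0).toNat, hlt a 0⟩, ⟨(ofLex a.1 1).toNat, hlt a 1⟩) with hg
  have hg0 : ∀ a, (((ofLex (g a)).1 : ℕ) : ℤ) = ofLex a.1 0 := fun a => by
    have h := (coord_mem_of_polySite_halfOpenBox a 0).1
    simp only [hg, ofLex_toLex]
    omega
  have hg1 : ∀ a, (((ofLex (g a)).2 : ℕ) : ℤ) = ofLex a.1 1 := fun a => by
    have h := (coord_mem_of_polySite_halfOpenBox a 1).1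
    simp only [hg, ofLex_toLex]
    omega
  have hinj : Function.Injective g := by
    intro a b h
    have h0 : ofLex a.1 0 = ofLex b.1 0 := by rw [← hg0 a, ← hg0 b, h]
    have h1 : ofLex a.1 1 = ofLex b.1 1 := by rw [← hg1 a, ← hg1 b, h]
    have : ofLex a.1 = ofLex b.1 := by
      funext i
      rcases fin_two_eq_zero_or_one i with rfl | rfl
      · exact h0
      · exact h1
    exact Subtype.ext (ofLex.injective this)
  have hsurj : Function.Surjective g := by
    intro p
    set x : Site 2 := ![(((ofLex p).1 : ℕ) : ℤ), (((ofLex p).2 : ℕ) : ℤ)] with hx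
    have hx0 : x 0 = ((ofLex p).1 : ℕ) := rfl
    have hx1 : x 1 = ((ofLex p).2 : ℕ) := rfl
    have hxmem : x ∈ halfOpenBox 2 ℓ := by
      rw [mem_halfOpenBox]
      intro i
      rcases fin_two_eq_zero_or_one i with rfl | rfl
      · rw [hx0]
        exact ⟨Nat.cast_nonneg _, by exact_mod_cast (ofLex p).1.isLt⟩
      · rw [hx1]
        exact ⟨Nat.cast_nonneg _, by exact_mod_cast (ofLex p).2.isLt⟩
    refine ⟨PolySite.pt x hxmem, ?_⟩
    refine ofLex.injective (Prod.ext (Fin.ext ?_) (Fin.ext ?_))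
    · have h := hg0 (PolySite.pt x hxmem)
      rw [PolySite.ofLex_coe_pt, hx0, Nat.cast_inj] at h
      exact h
    · have h := hg1 (PolySite.pt x hxmem)
      rw [PolySite.ofLex_coe_pt, hx1, Nat.cast_inj] at h
      exact h
  exact ⟨Equiv.ofBijective g ⟨hinj, hsurj⟩, hg0, hg1⟩

variable (f : PolySite (halfOpenBox 2 ℓ) ≃ Fin ℓ ×ₗ Fin ℓ)
  (hf0 : ∀ a, (((ofLex (f a)).1 : ℕ) : ℤ) = ofLex a.1 0) (hf1 : ∀ a, (((ofLex (f a)).2 : ℕ) : ℤ) = ofLex a.1 1)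

include hf0 hf1

/-- Box bonds are torus bonds: if `a ~ b` in `[0,ℓ)²` (they differ by a unit vector) then
`f a ~ f b` in the torus `ℤ/ℓℤ × ℤ/ℓℤ`. [folklore] -/
theorem fermionRectTorusGraph_adj_of_polyGraph_adj {a b : PolySite (halfOpenBox 2 ℓ)}
    (h : (polyGraph (halfOpenBox 2 ℓ)).Adj a b) : (fermionRectTorusGraph ℓ ℓ).Adj (f a) (f b) := by
  have h10 : (1 : Fin 2) ≠ 0 := by decide
  have h01 : (0 : Fin 2) ≠ 1 := by decide
  rw [polyGraph_adj, zdGraph_adj_iff] at h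
  have ha0 := hf0 a; have ha1 := hf1 a; have hb0 := hf0 b; have hb1 := hf1 b
  have hla0 := (ofLex (f a)).1.isLt; have hla1 := (ofLex (f a)).2.isLt
  have hlb0 := (ofLex (f b)).1.isLt; have hlb1 := (ofLex (f b)).2.isLt
  have hcast : ∀ {u v : ℕ}, (u : ℤ) ≠ v → u ≠ v := fun h h' => h (by rw [h'])
  rw [fermionRectTorusGraph_adj_iff]
  obtain ⟨i, hi | hi⟩ := h
  · have hc : ∀ j, ofLex b.1 j = ofLex a.1 j + (Pi.single i (1 : ℤ) : Site 2) j := fun j => by rw [hi]; rfl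
    rcases fin_two_eq_zero_or_one i with rfl | rfl
    · have hc0 := hc 0; have hc1 := hc 1
      rw [Pi.single_eq_same] at hc0
      rw [Pi.single_eq_of_ne h10] at hc1
      refine Or.inl ⟨Fin.ext ?_, hcast ?_, Or.inl ?_⟩
      · omega
      · omega
      · rw [Nat.mod_eq_of_lt (by omega)]; omega
    · have hc0 := hc 0; have hc1 := hc 1
      rw [Pi.single_eq_of_ne h01] at hc0
      rw [Pi.single_eq_same] at hc1
      refine Or.inr ⟨Fin.ext ?_, hcast ?_, Or.inl ?_⟩
      · omega
      · omega
      · rw [Nat.mod_eq_of_lt (by omega)]; omega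
  · have hc : ∀ j, ofLex a.1 j = ofLex b.1 j + (Pi.single i (1 : ℤ) : Site 2) j := fun j => by rw [hi]; rfl
    rcases fin_two_eq_zero_or_one i with rfl | rfl
    · have hc0 := hc 0; have hc1 := hc 1
      rw [Pi.single_eq_same] at hc0
      rw [Pi.single_eq_of_ne h10] at hc1
      refine Or.inl ⟨Fin.ext ?_, hcast ?_, Or.inr ?_⟩
      · omega
      · omega
      · rw [Nat.mod_eq_of_lt (by omega)]; omega
    · have hc0 := hc 0; have hc1 := hc 1
      rw [Pi.single_eq_of_ne h01] at hc0
      rw [Pi.single_eq_same] at hc1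
      refine Or.inr ⟨Fin.ext ?_, hcast ?_, Or.inr ?_⟩
      · omega
      · omega
      · rw [Nat.mod_eq_of_lt (by omega)]; omega

/-- Torus bonds issuing from an INTERIOR site of the box are box bonds: if no coordinate of `a`
is `0` or `ℓ - 1` and `f a ~ f b` in the torus, then `a ~ b` in `[0,ℓ)²`. [folklore] -/
theorem polyGraph_adj_of_fermionRectTorusGraph_adj_of_interior {a b : PolySite (halfOpenBox 2 ℓ)}
    (hint : ∀ i : Fin 2, ofLex a.1 i ≠ 0 ∧ ofLex a.1 i ≠ (ℓ : ℤ) - 1)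
    (h : (fermionRectTorusGraph ℓ ℓ).Adj (f a) (f b)) : (polyGraph (halfOpenBox 2 ℓ)).Adj a b := by
  have h10 : (1 : Fin 2) ≠ 0 := by decide
  have h01 : (0 : Fin 2) ≠ 1 := by decide
  have ha0 := hf0 a; have ha1 := hf1 a; have hb0 := hf0 b; have hb1 := hf1 b
  have hla0 := (ofLex (f a)).1.isLt; have hla1 := (ofLex (f a)).2.isLt
  have hlb0 := (ofLex (f b)).1.isLt; have hlb1 := (ofLex (f b)).2.isLt
  have hi0 := hint 0; have hi1 := hint 1
  rw [polyGraph_adj, zdGraph_adj_iff]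
  rw [fermionRectTorusGraph_adj_iff] at h
  -- equality of sites from equality of both coordinates
  have hsite : ∀ {x y : Site 2}, x 0 = y 0 → x 1 = y 1 → x = y := fun h0 h1 => by
    funext i
    rcases fin_two_eq_zero_or_one i with rfl | rfl
    exacts [h0, h1]
  -- `(u + 1) % ℓ = v` without wrap-around, and with wrap-around
  have hmod_of_lt : ∀ {u v : ℕ}, (u + 1) % ℓ = v → u + 1 < ℓ → v = u + 1 := fun h hlt => by
    rw [Nat.mod_eq_of_lt hlt] at h; exact h.symm
  have hmod_wrap : ∀ {u v : ℕ}, (u + 1) % ℓ = v → u < ℓ → ¬ (u + 1 < ℓ) → v = 0 := fun {u v} h hu hlt => by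
    have : u + 1 = ℓ := by omega
    rw [this, Nat.mod_self] at h
    exact h.symm
  rcases h with ⟨h2, -, hmod | hmod⟩ | ⟨h2, -, hmod | hmod⟩
  · -- direction 0, `b₀ = a₀ + 1`
    have h2' := congrArg (fun z : Fin ℓ => ((z : ℕ) : ℤ)) h2
    have hlt : ((ofLex (f a)).1 : ℕ) + 1 < ℓ := by
      by_contra hge
      exact hi0.2 (by rw [← ha0]; omega)
    have hv := hmod_of_lt hmod hlt
    refine ⟨0, Or.inl (hsite ?_ ?_)⟩
    · rw [Pi.add_apply, Pi.single_eq_same]; omega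
    · rw [Pi.add_apply, Pi.single_eq_of_ne h10]; omega
  · -- direction 0, `a₀ = b₀ + 1` (no wrap since `a₀ ≠ 0`)
    have h2' := congrArg (fun z : Fin ℓ => ((z : ℕ) : ℤ)) h2
    have hlt : ((ofLex (f b)).1 : ℕ) + 1 < ℓ := by
      by_contra hge
      have hz := hmod_wrap hmod hlb0 hge
      exact hi0.1 (by rw [← ha0, hz]; simp)
    have hv := hmod_of_lt hmod hlt
    refine ⟨0, Or.inr (hsite ?_ ?_)⟩
    · rw [Pi.add_apply, Pi.single_eq_same]; omega
    · rw [Pi.add_apply, Pi.single_eq_of_ne h10]; omega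
  · -- direction 1, `b₁ = a₁ + 1`
    have h2' := congrArg (fun z : Fin ℓ => ((z : ℕ) : ℤ)) h2
    have hlt : ((ofLex (f a)).2 : ℕ) + 1 < ℓ := by
      by_contra hge
      exact hi1.2 (by rw [← ha1]; omega)
    have hv := hmod_of_lt hmod hlt
    refine ⟨1, Or.inl (hsite ?_ ?_)⟩
    · rw [Pi.add_apply, Pi.single_eq_of_ne h01]; omega
    · rw [Pi.add_apply, Pi.single_eq_same]; omega
  · -- direction 1, `a₁ = b₁ + 1`
    have h2' := congrArg (fun z : Fin ℓ => ((z : ℕ) : ℤ)) h2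
    have hlt : ((ofLex (f b)).2 : ℕ) + 1 < ℓ := by
      by_contra hge
      have hz := hmod_wrap hmod hlb1 hge
      exact hi1.1 (by rw [← ha1, hz]; simp)
    have hv := hmod_of_lt hmod hlt
    refine ⟨1, Or.inr (hsite ?_ ?_)⟩
    · rw [Pi.add_apply, Pi.single_eq_of_ne h01]; omega
    · rw [Pi.add_apply, Pi.single_eq_same]; omega

/-- **The adjacency discrepancy between the box and the torus is a boundary effect**: the ordered
pairs on which the box adjacency of `[0,ℓ)²` and the torus adjacency of `ℤ/ℓℤ × ℤ/ℓℤ` (transported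
by `f`) disagree number at most `16 ℓ` (each is a torus bond issuing from one of the `≤ 4ℓ` sites
with a coordinate in `{0, ℓ-1}`, and torus degrees are `≤ 4`). [folklore] -/
theorem card_discrepancy_box_torus_le :
    #{p : PolySite (halfOpenBox 2 ℓ) × PolySite (halfOpenBox 2 ℓ) |
        ¬ ((fermionRectTorusGraph ℓ ℓ).Adj (f p.1) (f p.2) ↔ (polyGraph (halfOpenBox 2 ℓ)).Adj p.1 p.2)} ≤
      16 * ℓ := by
  classical
  set Bd : Finset (PolySite (halfOpenBox 2 ℓ)) :=
    univ.filter fun a => ∃ i : Fin 2, ofLex a.1 i = 0 ∨ ofLex a.1 i = (ℓ : ℤ) - 1 with hBd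
  -- every discrepancy is a torus bond from a boundary site
  have hsub : (univ.filter fun p : PolySite (halfOpenBox 2 ℓ) × PolySite (halfOpenBox 2 ℓ) =>
      ¬ ((fermionRectTorusGraph ℓ ℓ).Adj (f p.1) (f p.2) ↔ (polyGraph (halfOpenBox 2 ℓ)).Adj p.1 p.2)) ⊆
      Bd.biUnion fun a => (univ.filter fun b => (fermionRectTorusGraph ℓ ℓ).Adj (f a) (f b)).image (Prod.mk a) := by
    rintro ⟨a, b⟩ hp
    rw [mem_filter] at hp
    have hnot := hp.2
    have hadj : (fermionRectTorusGraph ℓ ℓ).Adj (f a) (f b) := by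
      by_contra h
      exact hnot ⟨fun h' => absurd h' h, fun h' => absurd (fermionRectTorusGraph_adj_of_polyGraph_adj f hf0 hf1 h') h⟩
    have hbd : ∃ i : Fin 2, ofLex a.1 i = 0 ∨ ofLex a.1 i = (ℓ : ℤ) - 1 := by
      by_contra hint
      have hint' : ∀ i : Fin 2, ofLex a.1 i ≠ 0 ∧ ofLex a.1 i ≠ (ℓ : ℤ) - 1 := fun i =>
        ⟨fun h => hint ⟨i, Or.inl h⟩, fun h => hint ⟨i, Or.inr h⟩⟩
      exact hnot ⟨fun _ => polyGraph_adj_of_fermionRectTorusGraph_adj_of_interior f hf0 hf1 hint' hadj,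
        fun _ => hadj⟩
    rw [mem_biUnion]
    exact ⟨a, mem_filter.2 ⟨mem_univ _, hbd⟩, mem_image.2 ⟨b, mem_filter.2 ⟨mem_univ _, hadj⟩, rfl⟩⟩
  -- torus degrees are at most 4
  have hdeg : ∀ a : PolySite (halfOpenBox 2 ℓ),
      #(univ.filter fun b => (fermionRectTorusGraph ℓ ℓ).Adj (f a) (f b)) ≤ 4 := by
    intro a
    calc #(univ.filter fun b => (fermionRectTorusGraph ℓ ℓ).Adj (f a) (f b))
        = #((univ.filter fun b => (fermionRectTorusGraph ℓ ℓ).Adj (f a) (f b)).image f) :=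
          (card_image_of_injective _ f.injective).symm
      _ ≤ #(univ.filter fun q => (fermionRectTorusGraph ℓ ℓ).Adj (f a) q) := by
          refine card_le_card fun q hq => ?_
          obtain ⟨b, hb, rfl⟩ := mem_image.1 hq
          exact mem_filter.2 ⟨mem_univ _, (mem_filter.1 hb).2⟩
      _ ≤ 4 := card_filter_fermionRectTorusGraph_adj_le ℓ ℓ (f a)
  -- the boundary has at most `4ℓ` sites: each coordinate slice has `≤ ℓ` sites
  have hslice0 : ∀ c : ℤ, #(univ.filter fun a : PolySite (halfOpenBox 2 ℓ) => ofLex a.1 0 = c) ≤ ℓ := by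
    intro c
    calc #(univ.filter fun a : PolySite (halfOpenBox 2 ℓ) => ofLex a.1 0 = c)
        ≤ #(univ : Finset (Fin ℓ)) := by
          refine card_le_card_of_injOn (fun a => (ofLex (f a)).2) (fun _ _ => mem_coe.2 (mem_univ _)) ?_
          intro a ha b hb hab
          have ha' := (mem_filter.1 (mem_coe.1 ha)).2
          have hb' := (mem_filter.1 (mem_coe.1 hb)).2
          have hfa := hf0 a; have hfb := hf0 b
          apply f.injective
          refine ofLex.injective (Prod.ext (Fin.ext ?_) (Fin.ext ?_))
          · omega
          · exact congrArg Fin.val hab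
      _ = ℓ := by rw [card_univ, Fintype.card_fin]
  have hslice1 : ∀ c : ℤ, #(univ.filter fun a : PolySite (halfOpenBox 2 ℓ) => ofLex a.1 1 = c) ≤ ℓ := by
    intro c
    calc #(univ.filter fun a : PolySite (halfOpenBox 2 ℓ) => ofLex a.1 1 = c)
        ≤ #(univ : Finset (Fin ℓ)) := by
          refine card_le_card_of_injOn (fun a => (ofLex (f a)).1) (fun _ _ => mem_coe.2 (mem_univ _)) ?_
          intro a ha b hb hab
          have ha' := (mem_filter.1 (mem_coe.1 ha)).2
          have hb' := (mem_filter.1 (mem_coe.1 hb)).2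
          have hfa := hf1 a; have hfb := hf1 b
          apply f.injective
          refine ofLex.injective (Prod.ext (Fin.ext ?_) (Fin.ext ?_))
          · exact congrArg Fin.val hab
          · omega
      _ = ℓ := by rw [card_univ, Fintype.card_fin]
  have hBd_le : #Bd ≤ 4 * ℓ := by
    have hcover : Bd ⊆ ((univ.filter fun a : PolySite (halfOpenBox 2 ℓ) => ofLex a.1 0 = 0) ∪
        (univ.filter fun a : PolySite (halfOpenBox 2 ℓ) => ofLex a.1 0 = (ℓ : ℤ) - 1)) ∪
        ((univ.filter fun a : PolySite (halfOpenBox 2 ℓ) => ofLex a.1 1 = 0) ∪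
        (univ.filter fun a : PolySite (halfOpenBox 2 ℓ) => ofLex a.1 1 = (ℓ : ℤ) - 1)) := by
      intro a ha
      rw [hBd, mem_filter] at ha
      obtain ⟨i, hi⟩ := ha.2
      simp only [mem_union, mem_filter, mem_univ, true_and]
      rcases fin_two_eq_zero_or_one i with rfl | rfl
      · exact Or.inl hi
      · exact Or.inr hi
    calc #Bd ≤ _ := card_le_card hcover
      _ ≤ (ℓ + ℓ) + (ℓ + ℓ) :=
          (card_union_le _ _).trans (add_le_add
            ((card_union_le _ _).trans (add_le_add (hslice0 0) (hslice0 _)))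
            ((card_union_le _ _).trans (add_le_add (hslice1 0) (hslice1 _))))
      _ = 4 * ℓ := by ring
  calc _ ≤ #(Bd.biUnion fun a => (univ.filter fun b => (fermionRectTorusGraph ℓ ℓ).Adj (f a) (f b)).image (Prod.mk a)) :=
        card_le_card hsub
    _ ≤ ∑ a ∈ Bd, #((univ.filter fun b => (fermionRectTorusGraph ℓ ℓ).Adj (f a) (f b)).image (Prod.mk a)) :=
        card_biUnion_le
    _ ≤ ∑ _a ∈ Bd, 4 := Finset.sum_le_sum fun a _ => card_image_le.trans (hdeg a)
    _ = 4 * #Bd := by rw [sum_const, smul_eq_mul, mul_comm]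
    _ ≤ 4 * (4 * ℓ) := Nat.mul_le_mul_left 4 hBd_le
    _ = 16 * ℓ := by ring

omit hf0 hf1 in
/-- The torus ground energies are the ground energies of the torus graph transported to the box
sites (graph isomorphism invariance, `groundEnergyAt_eq_of_iso`). [folklore] -/
theorem groundEnergyAt_rect_eq_comap (t U : ℝ) (N : ℕ) :
    groundEnergyAt (fermionRectTorusGraph ℓ ℓ) t U N =
      groundEnergyAt ((fermionRectTorusGraph ℓ ℓ).comap f) t U N :=
  groundEnergyAt_eq_of_iso ((fermionRectTorusGraph ℓ ℓ).comap f) (fermionRectTorusGraph ℓ ℓ) f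
    (fun _ _ => Iff.rfl) t U N

end Box

/-- **The torus energies are bounded by the free-boundary box energies plus a boundary term**:
`E_{ℓ×ℓ torus}(N) ≤ E_{[0,ℓ)² box}(N) + 32|t| ℓ` for every sector `N ≤ 2ℓ²`, where the box energy
is that of `hamiltonian (polyGraph (halfOpenBox 2 ℓ)) t U` (= the local Hamiltonian `Σ_{X⊆Λ}Φ(X)`
of the Hubbard interaction, `hubbardFermionInteraction_localHamiltonian`). Hence, with the tiling
lower bound `energyDensity2D_le`, the free-boundary energies per site are at least the thermodynamic
energy density up to `O(1/ℓ)`. (Ruelle (1969) §2.2, §3.3: independence of boundary conditions.)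
[cite: Ruelle1969, §3.3] -/
theorem groundEnergyAt_rect_le_polyGraph_halfOpenBox (ℓ : ℕ) (t U : ℝ) {N : ℕ} (hN : N ≤ 2 * (ℓ * ℓ)) :
    groundEnergyAt (fermionRectTorusGraph ℓ ℓ) t U N ≤
      groundEnergyAt (polyGraph (halfOpenBox 2 ℓ)) t U N + 32 * |t| * ℓ := by
  classical
  obtain ⟨f, hf0, hf1⟩ := exists_equiv_polySite_halfOpenBox_two ℓ
  have hcard : Fintype.card (PolySite (halfOpenBox 2 ℓ)) = ℓ * ℓ := by
    rw [Fintype.card_congr f, card_rectSites]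
  rw [groundEnergyAt_rect_eq_comap f]
  have h := groundEnergyAt_le_of_adj_discrepancy (polyGraph (halfOpenBox 2 ℓ)) ((fermionRectTorusGraph ℓ ℓ).comap f)
    t U (card_discrepancy_box_torus_le f hf0 hf1) (N := N) (by rwa [hcard])
  have : (2 : ℝ) * |t| * ((16 * ℓ : ℕ) : ℝ) = 32 * |t| * ℓ := by push_cast; ring
  linarith

end ThermodynamicLimit

end Literature.MathematicalPhysics.QuantumLattice

end
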